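import Summits.Langlands.Langlands.Theorems.HalfIntegralTwistCM.Negative.ModulusParallel
import Summits.Langlands.Langlands.Theorems.IrreducibilityBySelfDualityHalfIntegralTwistCMChevalleyKummerField
import Summits.Langlands.Langlands.Theorems.IrreducibilityBySelfDualityHalfIntegralTwistCMCyclotomicTwoPowerDescent
import Summits.Langlands.Langlands.Theorems.IrreducibilityBySelfDualityHalfIntegralTwistCMTwoPowChevalleyAssembly
import Summits.Langlands.Langlands.Theorems.IrreducibilityBySelfDualityHalfIntegralTwistCMCMDeepUnitsReal
import Summits.Langlands.Langlands.Theorems.IrreducibilityBySelfDualityHalfIntegralTwistCMWeilExtensionAux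
import Summits.Langlands.Langlands.Theorems.IrreducibilityBySelfDualityHalfIntegralTwistCMWeilExtension
import Summits.Langlands.Langlands.Theorems.IrreducibilityBySelfDualityHalfIntegralTwistCMUnitRelationCongruence
import Literature.NumberTheory.GaloisRepresentations.HeckeCharacterArchExistence
import Literature.NumberTheory.Automorphic.ClozelAlgebraicityRankOne
import Literature.NumberTheory.Automorphic.AutomorphicTwistNorm
import Literature.NumberTheory.Automorphic.ArchParameterTwistNorm
import Literature.NumberTheory.Automorphic.IdeleNormDetGL
import Mathlib.NumberTheory.Cyclotomic.Basic
import HarnessLib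

/-!
# Route `IrreducibilityBySelfDuality` — crux `HalfIntegralTwistCM` (stmt-Langlands-14036), PROVED

THE CRUX (the route's lever, pure `GL(1)`/unit arithmetic over a CM field): for `K` CM and exponent
functions `s₁ s₂` with (i) `s₁ - s₂ ∈ ℤ`, (ii) `s₁ ι - s₁ ῑ ∈ ℤ`, (iii) `(s₁-s₂) ι + (s₁-s₂) ῑ ∈ 2ℤ`,
(iv) a `GL₁` datum of archimedean parameter `{s₁ ι + s₂ ι}`, there is a `GL₁` datum `χ` of parameter
`{p ι}` with `p ι + s₁ ι ∈ 1/2 + ℤ` at every `ι`.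

CYCLE HAZARD (route KILL CRITERIA (e)): when the item closes the gate appends
`theorem HalfIntegralTwistCM_holds` to the route file with `import <this module>`, so this module does
NOT import `Summits.Langlands.Langlands.Theses.IrreducibilityBySelfDuality`; the closing theorem
`HalfIntegralTwistCM_proof` states the route decl body INLINED VERBATIM (rev 15), so its type is the
route decl `…Theses.IrreducibilityBySelfDuality.HalfIntegralTwistCM` by `δ`-unfolding.

THE LINE `two-primary-chevalley-core` (planner skeleton + lead's reshape; stubs all landed under
`Summit.Langlands.Langlands.Theorems.HalfIntegralTwistCM`): Weil's unit criterion in CONGRUENCE form —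
S1a `stub_chevalleyKummerField` (Chevalley with exact `n`-th powers over a totally complex field
containing `μ_n`: Kummer key step + `artinReciprocity_character_holds` + Hensel), S1b
`stub_cyclotomicTwoPowerDescent` (`K(ζ_{2^b})/K` loses no `2^b`-th powers when `√-1 ∈ K`), S1c
`stub_twoPowChevalleyAssembly` (⇒ 2-power Chevalley mod torsion), S2 `stub_weilExtension` (Weil's
extension lemma, congruence form), S3 `stub_unitRelationCongruence` (Weil necessity, congruence form),
S4 `stub_cmDeepUnitsReal` (deep CM units are torsion-free and real — the ONE use of CM).  The
composition `HalfIntegralTwistCM_of_statements` (the planner's kernel-checked glue, with the four stub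
statements as hypotheses and no auxiliary definition) does the archimedean bookkeeping: `e_w` even from
(i)+(ii)+(iii); on real deep units the unit product of the half type `(n, -T/2)` squares to the inverse
of that of `(e, T)`, so `χ_∞` is QUADRATIC on `V = U_{a₀ a₁}`; odd-index absorption feeds exponent
`2^(a+1)` to S1; S2 gives `ψ` of type `(n, -T/2)`; `χ := π_ψ ⊗ ‖·‖^r`, `r = (1-σ)/2` (`σ` the parallel real
part), has parameter `{p ι}` and `p ι + s₁ ι - 1/2 ∈ ℤ` at both embeddings of every place.  Disproof
obligations (crux `Disproof.lean` F2–F11) honoured: (ii) enters `n_w`, `IsCMField` only at S4, (iii) in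
`M_w`, (iv) in S3, shifts place-dependent, no unitary/real strengthening (`Im p = -T_w/4`).
-/

set_option linter.dupNamespace false -- project-wide option (lakefile weak.linter.dupNamespace); `Summit.Langlands.Langlands` is the mandated namespace

noncomputable section

open scoped NumberField ComplexConjugate
open NumberField NumberField.InfinitePlace
open Literature.NumberTheory.Automorphic Literature.NumberTheory.GaloisRepresentations
open Summit.Langlands.Langlands.Theorems.HalfIntegralTwistCM.Negative

namespace Summit.Langlands.Langlands.Theorems.HalfIntegralTwistCM.TwoPrimaryChevalleyCore

section Helpers

variable {K : Type} [Field K] [NumberField K]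

omit [NumberField K] in
/-- Membership in the congruence subgroup `U_a = ker (𝓞_Kˣ → (𝓞_K/a)ˣ)` is `a ∣ u - 1`. [folklore] -/
theorem mem_ker_unitsMap_quotient_iff {a : ℕ} {u : (𝓞 K)ˣ} :
    u ∈ (Units.map (Ideal.Quotient.mk (Ideal.span {(a : 𝓞 K)})).toMonoidHom).ker ↔
      (a : 𝓞 K) ∣ (u : 𝓞 K) - 1 := by
  simp only [MonoidHom.mem_ker, Units.ext_iff, Units.coe_map, RingHom.toMonoidHom_eq_coe,
    MonoidHom.coe_coe, Units.val_one]
  rw [← map_one (Ideal.Quotient.mk (Ideal.span {(a : 𝓞 K)})), Ideal.Quotient.eq,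
    Ideal.mem_span_singleton]

/-- The congruence subgroup `U_a = ker (𝓞_Kˣ → (𝓞_K/a)ˣ)` has non-zero index (`a > 0`). [folklore] -/
theorem index_ker_unitsMap_quotient_ne_zero {a : ℕ} (ha : 0 < a) :
    (Units.map (Ideal.Quotient.mk (Ideal.span {(a : 𝓞 K)})).toMonoidHom).ker.index ≠ 0 := by
  have hI : Ideal.span {(a : 𝓞 K)} ≠ ⊥ := by
    rw [Ne, Ideal.span_singleton_eq_bot]
    exact_mod_cast ha.ne'
  haveI : Finite (𝓞 K ⧸ Ideal.span {(a : 𝓞 K)}) := Ideal.finiteQuotientOfFreeOfNeBot _ hI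
  exact Subgroup.FiniteIndex.index_ne_zero

/-- `unitArchProduct K m t α` is the product of the local factors `archUnitaryValue (m w) (t w)` at the
embeddings `w.embedding α` (definitional unfolding). [folklore] -/
theorem unitArchProduct_eq (m : InfinitePlace K → ℤ) (t : InfinitePlace K → ℝ) (α : (𝓞 K)ˣ) :
    unitArchProduct K m t α =
      ∏ w : InfinitePlace K, archUnitaryValue (m w) (t w) (w.embedding ((α : 𝓞 K) : K)) :=
  rfl

omit [NumberField K] in
/-- A unit of `𝓞 K` is non-zero under every complex embedding. [folklore] -/
theorem embedding_unit_ne_zero (w : InfinitePlace K) (α : (𝓞 K)ˣ) :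
    w.embedding ((α : 𝓞 K) : K) ≠ 0 :=
  (map_ne_zero _).mpr (RingOfIntegers.coe_ne_zero_iff.mpr (Units.ne_zero α))

/-- The unit product of type `(m, t)` is non-zero (each factor has modulus `1`). [folklore] -/
theorem unitArchProduct_ne_zero (m : InfinitePlace K → ℤ) (t : InfinitePlace K → ℝ) (α : (𝓞 K)ˣ) :
    unitArchProduct K m t α ≠ 0 := by
  rw [unitArchProduct_eq]
  exact Finset.prod_ne_zero_iff.mpr fun w _ => norm_ne_zero_iff.mp
    (by rw [norm_archUnitaryValue (embedding_unit_ne_zero w α)]; exact one_ne_zero)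

/-- The unit product of type `(m, t)` is multiplicative in the unit. [folklore] -/
theorem unitArchProduct_mul (m : InfinitePlace K → ℤ) (t : InfinitePlace K → ℝ) (α β : (𝓞 K)ˣ) :
    unitArchProduct K m t (α * β) = unitArchProduct K m t α * unitArchProduct K m t β := by
  simp only [unitArchProduct_eq, Units.val_mul, map_mul, ← Finset.prod_mul_distrib]
  exact Finset.prod_congr rfl fun w _ => archUnitaryValue_mul' _ _

/-- The unit product of type `(m, t)` at `1` is `1`. [folklore] -/
theorem unitArchProduct_one (m : InfinitePlace K → ℤ) (t : InfinitePlace K → ℝ) :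
    unitArchProduct K m t 1 = 1 := by
  simp only [unitArchProduct_eq, Units.val_one, map_one, archUnitaryValue_one, Finset.prod_const_one]

variable (K) in
/-- The unit product of type `(m, t)` is a character `𝓞_Kˣ → ℂˣ` (existence form). [folklore] -/
theorem exists_unitArchProductHom (m : InfinitePlace K → ℤ) (t : InfinitePlace K → ℝ) :
    ∃ f : (𝓞 K)ˣ →* ℂˣ, ∀ α : (𝓞 K)ˣ, ((f α : ℂˣ) : ℂ) = unitArchProduct K m t α :=
  ⟨{ toFun := fun α => Units.mk0 (unitArchProduct K m t α) (unitArchProduct_ne_zero m t α)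
     map_one' := Units.ext (by rw [Units.val_mk0, Units.val_one, unitArchProduct_one])
     map_mul' := fun α β => Units.ext (by
       rw [Units.val_mul, Units.val_mk0, Units.val_mk0, Units.val_mk0, unitArchProduct_mul]) },
    fun _ => rfl⟩

/-- For a non-zero REAL complex number `z`, an even `e` and any `n`, `T`:
`archUnitaryValue n (-T/2) z ^ 2 * archUnitaryValue e T z = 1`
(`(±1)^{2n+e} = 1` and `|z|^{-iT/2·2} |z|^{iT} = 1`). -/
theorem archUnitaryValue_sq_mul_eq_one_of_conj_eq {z : ℂ} (hz : z ≠ 0) (hreal : conj z = z)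
    (n e : ℤ) (he : Even e) (T : ℝ) :
    archUnitaryValue n (-T / 2) z ^ 2 * archUnitaryValue e T z = 1 := by
  obtain ⟨e', rfl⟩ := he
  have hz' : ((z.re : ℝ) : ℂ) = z := Complex.conj_eq_iff_re.mp hreal
  have hr : z.re ≠ 0 := fun h => hz (by rw [← hz', h, Complex.ofReal_zero])
  rw [← hz']
  generalize z.re = r at hr
  unfold archUnitaryValue
  rw [Complex.norm_real, Real.norm_eq_abs]
  have habs : ((|r| : ℝ) : ℂ) ≠ 0 := by exact_mod_cast abs_ne_zero.mpr hr
  have hx : (r : ℂ) / ((|r| : ℝ) : ℂ) ≠ 0 := div_ne_zero (by exact_mod_cast hr) habs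
  have hsq : ((r : ℂ) / ((|r| : ℝ) : ℂ)) ^ (2 : ℤ) = 1 := by
    rw [zpow_ofNat, div_pow, ← Complex.ofReal_pow, ← Complex.ofReal_pow, sq_abs, div_self]
    exact_mod_cast pow_ne_zero 2 hr
  have hang : (((r : ℂ) / ((|r| : ℝ) : ℂ)) ^ n) ^ 2 * ((r : ℂ) / ((|r| : ℝ) : ℂ)) ^ (e' + e') = 1 := by
    rw [← zpow_natCast, ← zpow_mul, ← zpow_add₀ hx,
      show n * ((2 : ℕ) : ℤ) + (e' + e') = 2 * (n + e') by push_cast; ring, zpow_mul, hsq, one_zpow]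
  have hmod : ((((|r| : ℝ) : ℂ)) ^ (((-T / 2 : ℝ) : ℂ) * Complex.I)) ^ 2 *
      (((|r| : ℝ) : ℂ)) ^ ((T : ℂ) * Complex.I) = 1 := by
    rw [sq, ← Complex.cpow_add _ _ habs, ← Complex.cpow_add _ _ habs,
      show ((-T / 2 : ℝ) : ℂ) * Complex.I + ((-T / 2 : ℝ) : ℂ) * Complex.I + (T : ℂ) * Complex.I = 0 by
        push_cast; ring, Complex.cpow_zero]
  calc _ = ((((r : ℂ) / ((|r| : ℝ) : ℂ)) ^ n) ^ 2 * ((r : ℂ) / ((|r| : ℝ) : ℂ)) ^ (e' + e')) *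
        (((((|r| : ℝ) : ℂ)) ^ (((-T / 2 : ℝ) : ℂ) * Complex.I)) ^ 2 *
          (((|r| : ℝ) : ℂ)) ^ ((T : ℂ) * Complex.I)) := by ring
    _ = 1 := by rw [hang, hmod, one_mul]

/-- On a unit that is real under every embedding, the unit product of type `(n, -T/2)` squares to
the inverse of the unit product of type `(e, T)` when all `e_w` are even. -/
theorem unitArchProduct_sq_mul_eq_one {n e : InfinitePlace K → ℤ} (he : ∀ w, Even (e w))
    (T : InfinitePlace K → ℝ) {u : (𝓞 K)ˣ}
    (hreal : ∀ φ : K →+* ℂ, conj (φ ((u : 𝓞 K) : K)) = φ ((u : 𝓞 K) : K)) :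
    unitArchProduct K n (fun w => -(T w) / 2) u ^ 2 * unitArchProduct K e T u = 1 := by
  simp only [unitArchProduct_eq]
  rw [← Finset.prod_pow, ← Finset.prod_mul_distrib]
  exact Finset.prod_eq_one fun w _ =>
    archUnitaryValue_sq_mul_eq_one_of_conj_eq (embedding_unit_ne_zero w u) (hreal _) _ _ (he w) _

end Helpers

/-- **Odd-index absorption** (pure group theory; proof copied from the ideator's sketch, kernel-checked
there and here): `V ≤ U` of index `2^a · n`, `n` odd, `V` torsion-free, `ε` a character of `V`
trivial on squares; then `ε` kills every element of `V` of the form `ζ · w^(2^(a+1))`, `ζ` torsion. -/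
theorem oddIndexAbsorption {U : Type*} [CommGroup U] (V : Subgroup U) (a n : ℕ) (hn : Odd n)
    (hidx : V.index = 2 ^ a * n) (htf : ∀ v ∈ V, IsOfFinOrder v → v = 1)
    (ε : V →* ℂˣ) (hε : ∀ v : V, ε (v ^ 2) = 1)
    (u : V) (ζ w : U) (hζ : IsOfFinOrder ζ) (hu : (u : U) = ζ * w ^ (2 ^ (a + 1))) :
    ε u = 1 := by
  have hw : w ^ (2 ^ a * n) ∈ V := hidx ▸ V.pow_index_mem w
  set v₀ : V := ⟨w ^ (2 ^ a * n), hw⟩ with hv₀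
  have hpow : (u : U) ^ n = ζ ^ n * (v₀ : U) ^ 2 := by
    rw [hu, mul_pow, ← pow_mul, hv₀, Subgroup.coe_mk, ← pow_mul,
      show 2 ^ a * n * 2 = 2 ^ (a + 1) * n by ring]
  have hζn_mem : ζ ^ n ∈ V := by
    have h : (u : U) ^ n * ((v₀ : U) ^ 2)⁻¹ = ζ ^ n := by rw [hpow, mul_inv_cancel_right]
    rw [← h]
    exact V.mul_mem (V.pow_mem u.2 n) (V.inv_mem (V.pow_mem v₀.2 2))
  have hζn : ζ ^ n = 1 := htf _ hζn_mem hζ.pow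
  have hun : u ^ n = v₀ ^ 2 := by
    apply Subtype.ext
    rw [SubgroupClass.coe_pow, SubgroupClass.coe_pow, hpow, hζn, one_mul]
  have h1 : ε u ^ n = 1 := by rw [← map_pow, hun, hε]
  have h2 : ε u ^ 2 = 1 := by rw [← map_pow]; exact hε u
  obtain ⟨k, rfl⟩ := hn
  have h3 : ε u ^ (2 * k + 1) = (ε u ^ 2) ^ k * ε u := by rw [pow_succ, pow_mul]
  rw [h2, one_pow, one_mul, h1] at h3
  exact h3.symm

/-- **The glue, hypothesis form** (the planner's kernel-checked composition, axioms
`propext / Classical.choice / Quot.sound`): the four stub STATEMENTS — S1 (2-power Chevalley mod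
torsion) → S2 (Weil extension, congruence form) → S3 (Weil necessity, congruence form) → S4 (deep CM
units are torsion-free and real) — imply the crux `HalfIntegralTwistCM` (its route text, inlined), by
the congruence form of Weil's criterion with odd-index absorption; all archimedean bookkeeping is done
here. [folklore] -/
theorem HalfIntegralTwistCM_of_statements :
    (∀ (K : Type) [Field K] [NumberField K] (b : ℕ),
      ∃ a : ℕ, 0 < a ∧ ∀ u : (𝓞 K)ˣ, (a : 𝓞 K) ∣ (u : 𝓞 K) - 1 →
        ∃ ζ ∈ NumberField.Units.torsion K, ∃ w : (𝓞 K)ˣ, u = ζ * w ^ (2 ^ b)) →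
    (∀ (K : Type) [Field K] [NumberField K] (m : InfinitePlace K → ℤ) (t : InfinitePlace K → ℝ)
      (a : ℕ), 0 < a →
      (∀ u : (𝓞 K)ˣ, (a : 𝓞 K) ∣ (u : 𝓞 K) - 1 → unitArchProduct K m t u = 1) →
        ∃ ψ : HeckeCharacter K, ψ.HasUnitaryArchType m t) →
    (∀ (K : Type) [Field K] [NumberField K] [IsTotallyComplex K]
      (h1 : isCompact_glFiniteIntegralLevel 1 K) (ω : CuspidalAutomorphicRepData 1 K h1)
      (E : (K →+* ℂ) → ℂ), ω.1.HasArchParameter (fun ι => {E ι}) →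
        ∃ (e : InfinitePlace K → ℤ) (a : ℕ), 0 < a ∧
          (∀ w : InfinitePlace K,
            (e w : ℂ) = E w.embedding - E (ComplexEmbedding.conjugate w.embedding)) ∧
          ∀ u : (𝓞 K)ˣ, (a : 𝓞 K) ∣ (u : 𝓞 K) - 1 →
            unitArchProduct K e
              (fun w => (E w.embedding + E (ComplexEmbedding.conjugate w.embedding)).im) u = 1) →
    (∀ (K : Type) [Field K] [NumberField K], IsCMField K →
      ∃ a : ℕ, 0 < a ∧ ∀ u : (𝓞 K)ˣ, (a : 𝓞 K) ∣ (u : 𝓞 K) - 1 →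
        (IsOfFinOrder u → u = 1) ∧ ∀ φ : K →+* ℂ, conj (φ ((u : 𝓞 K) : K)) = φ ((u : 𝓞 K) : K)) →
    ∀ (K : Type) [Field K] [NumberField K], NumberField.IsCMField K → ∀ (h1 : Literature.NumberTheory.Automorphic.isCompact_glFiniteIntegralLevel 1 K) (s₁ s₂ : (K →+* ℂ) → ℂ), (∀ ι, ∃ k : ℤ, s₁ ι - s₂ ι = k) → (∀ ι, ∃ m : ℤ, s₁ ι - s₁ (NumberField.ComplexEmbedding.conjugate ι) = m) → (∀ ι, ∃ m : ℤ, (s₁ ι - s₂ ι) + (s₁ (NumberField.ComplexEmbedding.conjugate ι) - s₂ (NumberField.ComplexEmbedding.conjugate ι)) = 2 * m) → (∃ ω : Literature.NumberTheory.Automorphic.CuspidalAutomorphicRepData 1 K h1, ω.1.HasArchParameter (fun ι => {s₁ ι + s₂ ι})) → ∃ (χ : Literature.NumberTheory.Automorphic.CuspidalAutomorphicRepData 1 K h1) (p : (K →+* ℂ) → ℂ), χ.1.HasArchParameter (fun ι => {p ι}) ∧ ∀ ι, ∃ m : ℤ, p ι + s₁ ι - 1 / 2 = m := by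
  intro hS1 hS2 hS3 hS4 K _ _ hK hcpt s₁ s₂ hi hii hiii hω
  classical
  obtain ⟨ω, hω⟩ := hω
  haveI : IsCMField K := hK
  have hcx : ∀ w : InfinitePlace K, w.IsComplex := IsTotallyComplex.isComplex
  -- (S3) Weil necessity in congruence form for `ω`, exponents `E = s₁ + s₂`
  obtain ⟨e, a₀, ha₀, he, hkill₀⟩ := hS3 K hcpt ω (fun ι => s₁ ι + s₂ ι) hω
  obtain ⟨σ, -, hσ⟩ := exists_re_archParam_parallel_glOne ω.1 hω
  -- (S4) deep units are torsion-free and real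
  obtain ⟨a₁, ha₁, hdeep⟩ := hS4 K hK
  choose kk hkk using hi
  choose mII hmII using hii
  choose MM hMM using hiii
  -- notation: `T_w = Im E⁺_w`, `n_w = m_w + M_w`, unitary type `(n, -T/2)`
  set T : InfinitePlace K → ℝ :=
    fun w => (s₁ w.embedding + s₂ w.embedding +
      (s₁ (ComplexEmbedding.conjugate w.embedding) + s₂ (ComplexEmbedding.conjugate w.embedding))).im
    with hT
  set n : InfinitePlace K → ℤ := fun w => mII w.embedding + MM w.embedding with hn
  have hEsum : ∀ w : InfinitePlace K,
      s₁ w.embedding + s₂ w.embedding +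
        (s₁ (ComplexEmbedding.conjugate w.embedding) + s₂ (ComplexEmbedding.conjugate w.embedding)) =
        2 * σ + T w * Complex.I := by
    intro w
    have hre := hσ ⟨w, hcx w⟩ (s₁ w.embedding + s₂ w.embedding)
      (s₁ (ComplexEmbedding.conjugate w.embedding) + s₂ (ComplexEmbedding.conjugate w.embedding))
      rfl rfl
    apply Complex.ext
    · rw [hre]; simp
    · simp [hT]
  -- the angular integers `e_w` are even ((i) + (ii) + (iii))
  have heven : ∀ w, Even (e w) := by
    intro w
    have h1' := hkk w.embedding
    have h3' := hmII w.embedding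
    have h4' := hMM w.embedding
    have key : ((e w : ℤ) : ℂ) =
        ((2 * (mII w.embedding + MM w.embedding - kk w.embedding) : ℤ) : ℂ) := by
      rw [he w]
      push_cast
      linear_combination -2 * h1' + 2 * h3' + h4'
    exact ⟨mII w.embedding + MM w.embedding - kk w.embedding, by
      rw [Int.cast_injective key]; ring⟩
  -- the quadratic shadow: `(unit product of type (n, -T/2))² = 1` on `U_{a₀} ∩ U_{a₁}`
  have hsq : ∀ u : (𝓞 K)ˣ, (a₀ : 𝓞 K) ∣ (u : 𝓞 K) - 1 → (a₁ : 𝓞 K) ∣ (u : 𝓞 K) - 1 →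
      unitArchProduct K n (fun w => -(T w) / 2) u ^ 2 = 1 := by
    intro u hu₀ hu₁
    have h := unitArchProduct_sq_mul_eq_one (n := n) heven T (hdeep u hu₁).2
    have h0 : unitArchProduct K e T u = 1 := hkill₀ u hu₀
    rwa [h0, mul_one] at h
  have hdvd : ∀ {u : (𝓞 K)ˣ} (c d : ℕ), ((c * d : ℕ) : 𝓞 K) ∣ (u : 𝓞 K) - 1 →
      (c : 𝓞 K) ∣ (u : 𝓞 K) - 1 ∧ (d : 𝓞 K) ∣ (u : 𝓞 K) - 1 := fun c d h =>
    ⟨(Dvd.intro (d : 𝓞 K) (by push_cast; ring)).trans h,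
      (Dvd.intro (c : 𝓞 K) (by push_cast; ring)).trans h⟩
  -- the congruence subgroup `V = U_{a₀ a₁}` has index `2^a · (odd)`
  obtain ⟨a, nn, hnn, hidx⟩ :=
    Nat.exists_eq_two_pow_mul_odd (index_ker_unitsMap_quotient_ne_zero (K := K) (Nat.mul_pos ha₀ ha₁))
  -- (S1) 2-power Chevalley modulo torsion, exponent `2^(a+1)`
  obtain ⟨a₂, ha₂, hpow⟩ := hS1 K (a + 1)
  -- odd-index absorption: the type `(n, -T/2)` kills `U_{a₀ a₁ a₂}`
  have hkill : ∀ u : (𝓞 K)ˣ, ((a₀ * a₁ * a₂ : ℕ) : 𝓞 K) ∣ (u : 𝓞 K) - 1 →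
      unitArchProduct K n (fun w => -(T w) / 2) u = 1 := by
    intro u hu
    obtain ⟨hu01, hu2⟩ := hdvd (a₀ * a₁) a₂ hu
    obtain ⟨ζ, hζ, w, hw⟩ := hpow u hu2
    set V : Subgroup (𝓞 K)ˣ :=
      (Units.map (Ideal.Quotient.mk (Ideal.span {((a₀ * a₁ : ℕ) : 𝓞 K)})).toMonoidHom).ker with hV
    obtain ⟨f, hf⟩ := exists_unitArchProductHom K n (fun w => -(T w) / 2)
    let ε : V →* ℂˣ := f.comp V.subtype
    have hεsq : ∀ v : V, ε (v ^ 2) = 1 := by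
      intro v
      obtain ⟨hv0, hv1⟩ := hdvd a₀ a₁ (mem_ker_unitsMap_quotient_iff.mp v.2)
      rw [map_pow]
      ext
      rw [Units.val_pow_eq_pow_val, Units.val_one, MonoidHom.comp_apply, Subgroup.coe_subtype, hf]
      exact hsq v hv0 hv1
    have htf : ∀ v ∈ V, IsOfFinOrder v → v = 1 := fun v hv hfin =>
      (hdeep v (hdvd a₀ a₁ (mem_ker_unitsMap_quotient_iff.mp hv)).2).1 hfin
    have hζfin : IsOfFinOrder ζ := (CommGroup.mem_torsion _).mp hζ
    have key := oddIndexAbsorption V a nn hnn hidx htf ε hεsq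
      ⟨u, mem_ker_unitsMap_quotient_iff.mpr hu01⟩ ζ w hζfin hw
    have key' := congrArg (fun x : ℂˣ => (x : ℂ)) key
    rw [Units.val_one, MonoidHom.comp_apply, Subgroup.coe_subtype, hf] at key'
    exact key'
  -- (S2) Weil extension: a Hecke character `ψ` of unitary type `(n, -T/2)`
  obtain ⟨ψ, hψ⟩ := hS2 K n (fun w => -(T w) / 2) (a₀ * a₁ * a₂)
    (Nat.mul_pos (Nat.mul_pos ha₀ ha₁) ha₂) hkill
  -- GL(1) dictionary: `χ := π_ψ ⊗ ‖·‖^r`, `r = (1 - σ)/2`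
  set r : ℝ := (1 - σ) / 2 with hr
  obtain ⟨χr, hχr⟩ := exists_heckeCharacter_ideleNorm_cpow (K := K) ((r : ℝ) : ℂ)
  obtain ⟨π₀, hW₀, -⟩ := exists_cuspidal_detTwist_glOne hcpt ψ
  have hθ₀ := heckeCharacter_detTwist_glOne hW₀
  obtain ⟨P₀, hP₀⟩ := π₀.1.exists_hasArchParameter_glOne
  obtain ⟨-, hP₀cx⟩ := archParam_of_hasUnitaryArchType π₀.1 hθ₀ hψ hP₀
  obtain ⟨π₁, hW₁, hW₁'⟩ := exists_cuspidalAutomorphicRepData_map_mulChar_detTwist hχr π₀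
  have hP₁ := AutomorphicRepData.HasArchParameter.of_map_mulChar_detTwist hχr hW₁ hW₁' hP₀
  let p : (K →+* ℂ) → ℂ := fun φ =>
    if φ = (mk φ).embedding then
      (r : ℂ) + ((n (mk φ) : ℂ) + ((-(T (mk φ)) / 2 : ℝ) : ℂ) * Complex.I) / 2
    else (r : ℂ) + (-(n (mk φ) : ℂ) + ((-(T (mk φ)) / 2 : ℝ) : ℂ) * Complex.I) / 2
  have hne_of : ∀ φ : K →+* ℂ, (mk φ).embedding = ComplexEmbedding.conjugate φ →
      φ ≠ (mk φ).embedding := fun φ h hφ => by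
    have hc := isComplex_iff.mp (hcx (mk φ))
    rw [← hφ] at hc h
    exact hc (ComplexEmbedding.isReal_iff.mpr h.symm)
  refine ⟨π₁, p, ?_, fun φ => ?_⟩
  · -- the archimedean parameter of `π₁` is `{p ι}`
    have hfun : (fun σ' => (P₀ σ').map (· + ((r : ℝ) : ℂ))) = fun ι => ({p ι} : Multiset ℂ) := by
      funext φ
      obtain ⟨hemb, hconj⟩ := hP₀cx ⟨mk φ, hcx _⟩
      dsimp only at hemb hconj
      rcases embedding_mk_eq φ with h | h
      · have hp : p φ = (r : ℂ) + ((n (mk φ) : ℂ) + ((-(T (mk φ)) / 2 : ℝ) : ℂ) * Complex.I) / 2 :=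
          if_pos h.symm
        rw [hp]
        conv_lhs => rw [← h]
        rw [hemb, Multiset.map_singleton]
        congr 1
        ring
      · have hp : p φ = (r : ℂ) + (-(n (mk φ) : ℂ) + ((-(T (mk φ)) / 2 : ℝ) : ℂ) * Complex.I) / 2 :=
          if_neg (hne_of φ h)
        have h' : ComplexEmbedding.conjugate (mk φ).embedding = φ := by
          rw [h]; exact ComplexEmbedding.involutive_conjugate _ φ
        rw [hp]
        conv_lhs => rw [← h']
        rw [hconj, Multiset.map_singleton]
        congr 1
        ring
    rw [hfun] at hP₁
    exact hP₁
  · -- half-integrality `p ι + s₁ ι - 1/2 ∈ ℤ` at both embeddings of the place of `ι`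
    have hsum := hEsum (mk φ)
    have h3' := hmII (mk φ).embedding
    have h4' := hMM (mk φ).embedding
    rcases embedding_mk_eq φ with h | h
    · refine ⟨mII (mk φ).embedding + MM (mk φ).embedding, ?_⟩
      have hp : p φ = (r : ℂ) + ((n (mk φ) : ℂ) + ((-(T (mk φ)) / 2 : ℝ) : ℂ) * Complex.I) / 2 :=
        if_pos h.symm
      rw [hp]
      simp only [hn, hr]
      rw [h] at hsum h3' h4' ⊢
      push_cast
      linear_combination (1 / 4 : ℂ) * hsum + (1 / 2 : ℂ) * h3' + (1 / 4 : ℂ) * h4'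
    · refine ⟨-mII (mk φ).embedding, ?_⟩
      have hp : p φ = (r : ℂ) + (-(n (mk φ) : ℂ) + ((-(T (mk φ)) / 2 : ℝ) : ℂ) * Complex.I) / 2 :=
        if_neg (hne_of φ h)
      have h' : ComplexEmbedding.conjugate (mk φ).embedding = φ := by
        rw [h]; exact ComplexEmbedding.involutive_conjugate _ φ
      rw [hp]
      simp only [hn, hr]
      rw [h'] at hsum h3' h4'
      push_cast
      linear_combination (1 / 4 : ℂ) * hsum - (1 / 2 : ℂ) * h3' + (1 / 4 : ℂ) * h4'

section Closing

-- the `open` lines of the route file, so that the inlined body elaborates as in the route module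
open scoped BigOperators Topology Manifold Classical MeasureTheory ProbabilityTheory Matrix InnerProductSpace ComplexConjugate ContinuousMap
open Filter Set Function TopologicalSpace MeasureTheory

/-- **The crux `HalfIntegralTwistCM` (stmt-Langlands-14036) holds** (half-integral re-twisting over a
CM field; the type is the route decl `…Theses.IrreducibilityBySelfDuality.HalfIntegralTwistCM` with its
body inlined verbatim, see the module docstring): the composition `HalfIntegralTwistCM_of_statements`
fed with the six landed stubs of line `two-primary-chevalley-core` (S1 = S1c applied to S1a, S1b).
[folklore] -/
theorem HalfIntegralTwistCM_proof :
    ∀ (K : Type) [Field K] [NumberField K], NumberField.IsCMField K → ∀ (h1 : Literature.NumberTheory.Automorphic.isCompact_glFiniteIntegralLevel 1 K) (s₁ s₂ : (K →+* ℂ) → ℂ), (∀ ι, ∃ k : ℤ, s₁ ι - s₂ ι = k) → (∀ ι, ∃ m : ℤ, s₁ ι - s₁ (NumberField.ComplexEmbedding.conjugate ι) = m) → (∀ ι, ∃ m : ℤ, (s₁ ι - s₂ ι) + (s₁ (NumberField.ComplexEmbedding.conjugate ι) - s₂ (NumberField.ComplexEmbedding.conjugate ι)) = 2 * m) → (∃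 ω : Literature.NumberTheory.Automorphic.CuspidalAutomorphicRepData 1 K h1, ω.1.HasArchParameter (fun ι => {s₁ ι + s₂ ι})) → ∃ (χ : Literature.NumberTheory.Automorphic.CuspidalAutomorphicRepData 1 K h1) (p : (K →+* ℂ) → ℂ), χ.1.HasArchParameter (fun ι => {p ι}) ∧ ∀ ι, ∃ m : ℤ, p ι + s₁ ι - 1 / 2 = m := by
  refine HalfIntegralTwistCM_of_statements ?_ ?_ ?_ ?_
  · exact stub_twoPowChevalleyAssembly stub_chevalleyKummerField stub_cyclotomicTwoPowerDescent
  · intro K _ _ m t a ha h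
    exact stub_weilExtension K m t a ha fun u hu => by rw [← unitArchProduct_eq]; exact h u hu
  · exact stub_unitRelationCongruence
  · exact stub_cmDeepUnitsReal

end Closing

end Summit.Langlands.Langlands.Theorems.HalfIntegralTwistCM.TwoPrimaryChevalleyCore
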